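import Literature.AnabelianGeometry.AbsoluteAnabelian.MLFGaloisTLGUnitsFunctor
import Literature.AnabelianGeometry.AbsoluteAnabelian.MLFGaloisIntegersFunctor

/-!
# `𝒯𝔾` and the compatible forgetful functors `𝒞^MLF_T → 𝒯𝔾`, `(Π ↷ M) ↦ Π` ([AbsTopIII] Def 3.1 (iii))

S. Mochizuki, *Topics in absolute anabelian geometry III*, §3, Def. 3.1 (iii) p. 68 (bib key
`MochizukiAbsTopIII2015`; locators = kurims manuscript pages, lit key `paper:url-5493eb38cbb7`):
"Finally, we shall write `𝒯𝔾` for the category of topological groups and continuous homomorphisms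
[...].  Thus, for `T ∈ {TF, TCG, TLG, TM, TS, TS⊞}`, the assignment `(Π ↷ M) ↦ Π` determines various
compatible natural functors `𝒞^MLF_T → 𝒯𝔾` [as well as double underlined versions of these functors]."

This file (seat abc-iut-L4-t2; closes the Def. 3.1 (iii) functor package `MLFGaloisGroupification` /
`MLFGaloisUnitsFunctors` / `MLFGaloisIntegersFunctor` / `MLFGaloisTLGUnits[Functor]`) types the last
sentence for `T ∈ {TF, TCG, TLG, TM}`:

* `TopGrpCat` — **`𝒯𝔾`**: topological groups and CONTINUOUS HOMOMORPHISMS (Mathlib's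
  `ContinuousMonoidHom`; Mathlib has `ProfiniteGrp` but no category of all topological groups; the
  double-underlined `𝒯𝔾` — isomorphisms only — is abc-iut-L4-t9's `AbsTopIII.TopGroupObj`);
* `GaloisMonoidPair.toTG`, `GaloisFieldPair.toTG` — `(Π ↷ M) ↦ Π`, `(φ_Π, φ_M) ↦ φ_Π` on all pairs, and
  their restrictions `MLFGaloisMonoidPairCat.toTG T : 𝒞^MLF_T ⥤ 𝒯𝔾`, `MLFGaloisFieldPairCat.toTG`,
  `MLFGaloisMonoidPairCompactCat.toTG T`, `MLFGaloisFieldPairCompactCat.toTG`;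
* **compatibility** ("compatible natural functors"): the four natural functors of Def. 3.1 (iii) commute
  with `(Π ↷ M) ↦ Π` ON THE NOSE — `tmToTLG_comp_toTG`, `tmToTCG_comp_toTG`, `tfToTM_comp_toTG`,
  `tlgToTCG_comp_toTG` (equalities of functors, by `rfl`: the Galois component is untouched).

Deliberately NOT here: `T ∈ {TS, TS⊞}` (no MLF-Galois `TS`-pair category with morphisms is typed; the
double-underlined model version is abc-iut-L4-t9's `TSObj.gal`), the subcategories `𝒯𝔾 ⊇ 𝒯𝔾^hyp ⊇ 𝒯𝔾^sB`
(scheme-theoretic: étale fundamental groups of hyperbolic orbicurves; seat abc-iut-L4-t1's `CurveModel`).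
HONEST FRAMING: bookkeeping over OUR kernel definitions; nothing here bears on [IUTchIII] Cor. 3.12.
-/

noncomputable section

universe u

namespace Literature.AnabelianGeometry.AbsoluteAnabelian

open _root_.CategoryTheory

/-! ### `𝒯𝔾`: topological groups and continuous homomorphisms -/

/-- **`𝒯𝔾`**, "the category of topological groups and continuous homomorphisms": an object is a
topological group. [cite: MochizukiAbsTopIII2015, Definition 3.1 (iii) p.68] -/
structure TopGrpCat : Type (u + 1) where
  /-- The underlying topological group. -/
  carrier : Type u
  [instGroup : Group carrier]
  [instTop : TopologicalSpace carrier]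
  [instTopGroup : IsTopologicalGroup carrier]

attribute [instance] TopGrpCat.instGroup TopGrpCat.instTop TopGrpCat.instTopGroup

namespace TopGrpCat

/-- The object of `𝒯𝔾` determined by a topological group. [cite: MochizukiAbsTopIII2015, Definition 3.1 (iii) p.68] -/
abbrev of (G : Type u) [Group G] [TopologicalSpace G] [IsTopologicalGroup G] : TopGrpCat.{u} := ⟨G⟩

/-- **`𝒯𝔾` is a category**: morphisms are the continuous homomorphisms (Mathlib `ContinuousMonoidHom`).
[cite: MochizukiAbsTopIII2015, Definition 3.1 (iii) p.68] -/
instance category : Category TopGrpCat.{u} where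
  Hom A B := A.carrier →ₜ* B.carrier
  id A := ContinuousMonoidHom.id A.carrier
  comp f g := g.comp f
  id_comp _ := ContinuousMonoidHom.ext fun _ => rfl
  comp_id _ := ContinuousMonoidHom.ext fun _ => rfl
  assoc _ _ _ := ContinuousMonoidHom.ext fun _ => rfl

end TopGrpCat

/-! ### `(Π ↷ M) ↦ Π` on all pairs -/

/-- **`(Π ↷ M) ↦ Π` on pairs of `TCG/TLG/TM`-shape**: `(φ_Π, φ_M) ↦ φ_Π` (continuous by Def 3.1 (ii)).
[cite: MochizukiAbsTopIII2015, Definition 3.1 (iii) p.68] -/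
def GaloisMonoidPair.toTG : GaloisMonoidPair.{u} ⥤ TopGrpCat.{u} where
  obj P := TopGrpCat.of P.Pi
  map φ := ⟨GaloisMonoidPair.Hom.homPi φ, GaloisMonoidPair.Hom.continuous_homPi φ⟩
  map_id _ := ContinuousMonoidHom.ext fun _ => rfl
  map_comp _ _ := ContinuousMonoidHom.ext fun _ => rfl

/-- **`(Π ↷ M) ↦ Π` on pairs of `TF`-shape.** [cite: MochizukiAbsTopIII2015, Definition 3.1 (iii) p.68] -/
def GaloisFieldPair.toTG : GaloisFieldPair.{u} ⥤ TopGrpCat.{u} where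
  obj P := TopGrpCat.of P.Pi
  map φ := ⟨GaloisFieldPair.Hom.homPi φ, GaloisFieldPair.Hom.continuous_homPi φ⟩
  map_id _ := ContinuousMonoidHom.ext fun _ => rfl
  map_comp _ _ := ContinuousMonoidHom.ext fun _ => rfl

/-- `toTG` on objects. [cite: MochizukiAbsTopIII2015, Definition 3.1 (iii) p.68] -/
@[simp] theorem GaloisMonoidPair.toTG_obj (P : GaloisMonoidPair.{u}) :
    GaloisMonoidPair.toTG.obj P = TopGrpCat.of P.Pi := rfl

/-- `toTG` on morphisms: `(φ_Π, φ_M) ↦ φ_Π`. [cite: MochizukiAbsTopIII2015, Definition 3.1 (iii) p.68] -/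
theorem GaloisMonoidPair.toTG_map {P Q : GaloisMonoidPair.{u}} (φ : P ⟶ Q) :
    GaloisMonoidPair.toTG.map φ = (⟨GaloisMonoidPair.Hom.homPi φ, GaloisMonoidPair.Hom.continuous_homPi φ⟩ :
      TopGrpCat.of P.Pi ⟶ TopGrpCat.of Q.Pi) := rfl

/-- `toTG` on objects (`TF`). [cite: MochizukiAbsTopIII2015, Definition 3.1 (iii) p.68] -/
@[simp] theorem GaloisFieldPair.toTG_obj (P : GaloisFieldPair.{u}) :
    GaloisFieldPair.toTG.obj P = TopGrpCat.of P.Pi := rfl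

/-- `toTG` on morphisms (`TF`): `(φ_Π, φ_M) ↦ φ_Π`. [cite: MochizukiAbsTopIII2015, Definition 3.1 (iii) p.68] -/
theorem GaloisFieldPair.toTG_map {P Q : GaloisFieldPair.{u}} (φ : P ⟶ Q) :
    GaloisFieldPair.toTG.map φ = (⟨GaloisFieldPair.Hom.homPi φ, GaloisFieldPair.Hom.continuous_homPi φ⟩ :
      TopGrpCat.of P.Pi ⟶ TopGrpCat.of Q.Pi) := rfl

/-! ### The natural functors `𝒞^MLF_T → 𝒯𝔾` -/

/-- The inclusion `𝒞^MLF_T ⥤` (all pairs), `T ∈ {TCG, TLG, TM}`. [cite: MochizukiAbsTopIII2015, Definition 3.1 (iii) p.67] -/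
def MLFGaloisMonoidPairCat.incl (T : PairType) : MLFGaloisMonoidPairCat.{u} T ⥤ GaloisMonoidPair.{u} where
  obj P := P.obj
  map φ := φ.hom

/-- The inclusion `𝒞^MLF_TF ⥤` (all `TF`-pairs). [cite: MochizukiAbsTopIII2015, Definition 3.1 (iii) p.67] -/
def MLFGaloisFieldPairCat.incl : MLFGaloisFieldPairCat.{u} ⥤ GaloisFieldPair.{u} where
  obj P := P.obj
  map φ := φ.hom

/-- The inclusion of the compact-Galois-group subcategory, `T ∈ {TCG, TLG, TM}`.
[cite: MochizukiAbsTopIII2015, Definition 3.1 (iii) p.67] -/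
def MLFGaloisMonoidPairCompactCat.incl (T : PairType) :
    MLFGaloisMonoidPairCompactCat.{u} T ⥤ GaloisMonoidPair.{u} where
  obj P := P.obj
  map φ := φ.hom

/-- The inclusion of the compact-Galois-group subcategory, `T = TF`. [cite: MochizukiAbsTopIII2015, Definition 3.1 (iii) p.67] -/
def MLFGaloisFieldPairCompactCat.incl : MLFGaloisFieldPairCompactCat.{u} ⥤ GaloisFieldPair.{u} where
  obj P := P.obj
  map φ := φ.hom

/-- **Def 3.1 (iii): the natural functor `𝒞^MLF_T → 𝒯𝔾`, `(Π ↷ M) ↦ Π`**, `T ∈ {TCG, TLG, TM}`.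
[cite: MochizukiAbsTopIII2015, Definition 3.1 (iii) p.68] -/
def MLFGaloisMonoidPairCat.toTG (T : PairType) : MLFGaloisMonoidPairCat.{u} T ⥤ TopGrpCat.{u} :=
  MLFGaloisMonoidPairCat.incl T ⋙ GaloisMonoidPair.toTG

/-- **Def 3.1 (iii): the natural functor `𝒞^MLF_TF → 𝒯𝔾`, `(Π ↷ M) ↦ Π`.**
[cite: MochizukiAbsTopIII2015, Definition 3.1 (iii) p.68] -/
def MLFGaloisFieldPairCat.toTG : MLFGaloisFieldPairCat.{u} ⥤ TopGrpCat.{u} :=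
  MLFGaloisFieldPairCat.incl ⋙ GaloisFieldPair.toTG

/-- `𝒞^MLF_T → 𝒯𝔾` on the compact-Galois-group subcategory. [cite: MochizukiAbsTopIII2015, Definition 3.1 (iii) p.68] -/
def MLFGaloisMonoidPairCompactCat.toTG (T : PairType) : MLFGaloisMonoidPairCompactCat.{u} T ⥤ TopGrpCat.{u} :=
  MLFGaloisMonoidPairCompactCat.incl T ⋙ GaloisMonoidPair.toTG

/-- `𝒞^MLF_TF → 𝒯𝔾` on the compact-Galois-group subcategory. [cite: MochizukiAbsTopIII2015, Definition 3.1 (iii) p.68] -/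
def MLFGaloisFieldPairCompactCat.toTG : MLFGaloisFieldPairCompactCat.{u} ⥤ TopGrpCat.{u} :=
  MLFGaloisFieldPairCompactCat.incl ⋙ GaloisFieldPair.toTG

/-! ### Compatibility: the natural functors of Def 3.1 (iii) commute with `(Π ↷ M) ↦ Π` on the nose -/

/-- **Compatibility, `𝒞_TM → 𝒞_TLG`**: `(Π ↷ M) ↦ (Π ↷ M^gp) ↦ Π` is `(Π ↷ M) ↦ Π`.
[cite: MochizukiAbsTopIII2015, Definition 3.1 (iii) p.68] -/
theorem tmToTLG_comp_toTG :
    tmToTLG.{u} ⋙ MLFGaloisMonoidPairCat.toTG .TLG = MLFGaloisMonoidPairCat.toTG .TM := rfl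

/-- **Compatibility, `𝒞_TM → 𝒞_TCG`**: `(Π ↷ M) ↦ (Π ↷ M^×) ↦ Π` is `(Π ↷ M) ↦ Π`.
[cite: MochizukiAbsTopIII2015, Definition 3.1 (iii) p.68] -/
theorem tmToTCG_comp_toTG :
    tmToTCG.{u} ⋙ MLFGaloisMonoidPairCat.toTG .TCG = MLFGaloisMonoidPairCat.toTG .TM := rfl

/-- **Compatibility, `𝒞_TF → 𝒞_TM`**: `(Π ↷ M) ↦ (Π ↷ 𝒪^⊳) ↦ Π` is `(Π ↷ M) ↦ Π`.
[cite: MochizukiAbsTopIII2015, Definition 3.1 (iii) p.68] -/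
theorem tfToTM_comp_toTG :
    tfToTM.{u} ⋙ MLFGaloisMonoidPairCat.toTG .TM = MLFGaloisFieldPairCompactCat.toTG := rfl

/-- **Compatibility, `𝒞_TLG → 𝒞_TCG`**: `(Π ↷ M) ↦ (Π ↷ 𝒪^×) ↦ Π` is `(Π ↷ M) ↦ Π`.
[cite: MochizukiAbsTopIII2015, Definition 3.1 (iii) p.68] -/
theorem tlgToTCG_comp_toTG :
    tlgToTCG.{u} ⋙ MLFGaloisMonoidPairCat.toTG .TCG = MLFGaloisMonoidPairCompactCat.toTG .TLG := rfl

end Literature.AnabelianGeometry.AbsoluteAnabelian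

end
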